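/-
Copyright (c) 2026 the pub-hodgecm-mathlib formalisation cell (harness21).  Prover seat hodgecm-mathlib-K2Liu-p11 (g2), Track B «K2-LIT»,
#184♮ = hLiu418 = `stmt-HodgeConjecture-24832`; organ (σ) A7-val, V6-inst (m2)+(m4) (LEAD F0P6-plan (g14) BATCH #18 (1): `K2LiuIsotropicLineStabiliserClosed`).
THEOREMS ONLY (no `def`, no `instance`, no notation, no named-fact hypothesis, no `sorry`); GENERIC over a Hausdorff topological ring of coordinates.
-/
import Mathlib.Topology.Algebra.Ring.Basic
import Mathlib.Topology.Algebra.Group.Basic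
import Mathlib.Topology.Compactness.LocallyCompact
import Mathlib.Topology.Bases
import Mathlib.Algebra.Group.Subgroup.Basic
import HarnessLib

/-!
# Crux `HLiu418`, (σ) V6-inst (m2)+(m4): THE STABILISER OF A LINE WITH A UNIT COORDINATE IS CLOSED (hence locally compact, second countable, Hausdorff)

Cell `hodgecm-mathlib`, crux item hLiu418 = `stmt-HodgeConjecture-24832` (helper lane `--supports`, count-neutral).

The parabolic `P′ ≤ G = U(V′_v)` of the Ikeda functional (★ V8d `K2LiuA7ValueFace.exists_average`: binders `[LocallyCompactSpace ↥P]`, closedness) is the stabiliser of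
the isotropic line `R·x′ ⊂ V′_v`.  Over the coordinate ring `R = L ⊗ L⁺_v` (a field at non-split `v`, `L⁺_v × L⁺_v` at split `v` — NOT a domain, so no rank-one
criterion), normalise the isotropic vector to have a coordinate `x′ i₀ = 1`; then `g·x′ ∈ R·x′ ⇔ ∀ i, (g·x′) i = (g·x′) i₀ · x′ i` — finitely many equations between
continuous functions of `g` — so the stabiliser is CLOSED in `G` as soon as `g ↦ g·x′` is continuous and `R` is Hausdorff with continuous multiplication.
GENERIC: `f : G → ι → R` is the orbit map `g ↦ g·x′` (instance: K2Liu-p09's I-2∕I-3 action of `localPi L c M₂ (diagonal dV′) v` on `Fin M₂ → LocalRing L v`).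
* §1 `exists_smul_eq_iff_forall (hx : x i₀ = 1) : (∃ t, w = t • x) ↔ ∀ i, w i = w i₀ * x i`;
* §2 `isClosed_setOf_forall_apply_eq_mul`, **`isClosed_setOf_exists_smul_eq (hf : Continuous f) (hx : x i₀ = 1) : IsClosed {g | ∃ t : R, f g = t • x}`**;
* §3 subgroup packaging: **`isClosed_subgroup_of_coe_eq`** ((m2)), **`locallyCompactSpace_subgroup_of_coe_eq`** + `secondCountable`∕`t2` ((m4)) — for any `P : Subgroup G` whose
  carrier is that stabiliser set (the decl of `P′` is V8-inst's; this file is agnostic of it).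
References: [KudlaSweet1997, §1]; [BorelJacquet1979, §4.1]; [GanQiuTakeda2014, §5.6].
HONEST LABEL: HC_CM is proved only modulo the 7 printed citations (2 remaining named inputs: hLiu418 = stmt-HodgeConjecture-24832,
h413 = stmt-HodgeConjecture-24833) until rung 0 closes; count-neutral helper, closes no socket.
-/

set_option autoImplicit false
set_option linter.dupNamespace false

namespace Summit.HodgeConjecture.HodgeConjecture.Cruxes.HLiu418.K2LiuIsotropicLineStabiliserClosed

variable {R : Type*} [CommSemiring R] {ι : Type*}

/-! ## §1  Lines through a vector with a unit coordinate -/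

/-- `w ∈ R·x` iff `w i = w i₀ · x i` for all `i`, when `x i₀ = 1`. [folklore] -/
theorem exists_smul_eq_iff_forall {x w : ι → R} {i₀ : ι} (hx : x i₀ = 1) : (∃ t : R, w = t • x) ↔ ∀ i, w i = w i₀ * x i := by
  constructor
  · rintro ⟨t, rfl⟩ i
    simp [Pi.smul_apply, smul_eq_mul, hx]
  · intro h
    refine ⟨w i₀, funext fun i => ?_⟩
    rw [Pi.smul_apply, smul_eq_mul]
    exact h i

/-- The stabiliser set, rewritten as finitely∕arbitrarily many equations. [folklore] -/
theorem setOf_exists_smul_eq {G : Type*} (f : G → ι → R) {x : ι → R} {i₀ : ι} (hx : x i₀ = 1) :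
    {g : G | ∃ t : R, f g = t • x} = {g : G | ∀ i, f g i = f g i₀ * x i} := by
  ext g
  exact exists_smul_eq_iff_forall hx

/-! ## §2  Closedness -/

/-- Each equation `f g i = f g i₀ · x i` cuts out a closed set (Hausdorff coordinates, continuous multiplication, continuous orbit map). [folklore] -/
theorem isClosed_setOf_forall_apply_eq_mul [TopologicalSpace R] [T2Space R] [ContinuousMul R] {G : Type*} [TopologicalSpace G] (f : G → ι → R)
    (hf : Continuous f) (x : ι → R) (i₀ : ι) : IsClosed {g : G | ∀ i, f g i = f g i₀ * x i} := by
  have h : {g : G | ∀ i, f g i = f g i₀ * x i} = ⋂ i, {g : G | f g i = f g i₀ * x i} := by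
    ext g
    simp
  rw [h]
  refine isClosed_iInter fun i => ?_
  exact isClosed_eq ((continuous_apply i).comp hf) (((continuous_apply i₀).comp hf).mul continuous_const)

/-- **(m2) THE STABILISER OF THE LINE `R·x` IS CLOSED**: `{g | ∃ t, f g = t • x}` is closed when `g ↦ f g` (the orbit map `g ↦ g·x`) is continuous, `x i₀ = 1`, and the
coordinate ring is Hausdorff with continuous multiplication. [KudlaSweet1997, §1] [BorelJacquet1979, §4.1] -/
theorem isClosed_setOf_exists_smul_eq [TopologicalSpace R] [T2Space R] [ContinuousMul R] {G : Type*} [TopologicalSpace G] (f : G → ι → R)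
    (hf : Continuous f) {x : ι → R} {i₀ : ι} (hx : x i₀ = 1) : IsClosed {g : G | ∃ t : R, f g = t • x} := by
  rw [setOf_exists_smul_eq f hx]
  exact isClosed_setOf_forall_apply_eq_mul f hf x i₀

omit [CommSemiring R] in
/-- Coordinatewise form of the continuity hypothesis: `f` is continuous iff every coordinate `g ↦ f g i` is. [folklore] -/
theorem continuous_of_forall_apply [TopologicalSpace R] {G : Type*} [TopologicalSpace G] (f : G → ι → R) (hf : ∀ i, Continuous fun g => f g i) :
    Continuous f :=
  continuous_pi hf

/-! ## §3  Subgroup packaging: (m2) and (m4) for the parabolic `P′` -/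

/-- **(m2) FOR A SUBGROUP**: a subgroup `P ≤ G` whose carrier is the stabiliser of the line `R·x` is closed. [KudlaSweet1997, §1] -/
theorem isClosed_subgroup_of_coe_eq [TopologicalSpace R] [T2Space R] [ContinuousMul R] {G : Type*} [Group G] [TopologicalSpace G] (P : Subgroup G)
    (f : G → ι → R) (hf : Continuous f) {x : ι → R} {i₀ : ι} (hx : x i₀ = 1) (hP : (P : Set G) = {g : G | ∃ t : R, f g = t • x}) :
    IsClosed (P : Set G) := by
  rw [hP]
  exact isClosed_setOf_exists_smul_eq f hf hx

/-- **(m4) FOR A SUBGROUP**: such a `P` is locally compact (closed in a locally compact `G`). [BorelJacquet1979, §4.1] -/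
theorem locallyCompactSpace_subgroup_of_coe_eq [TopologicalSpace R] [T2Space R] [ContinuousMul R] {G : Type*} [Group G] [TopologicalSpace G]
    [LocallyCompactSpace G] (P : Subgroup G) (f : G → ι → R) (hf : Continuous f) {x : ι → R} {i₀ : ι} (hx : x i₀ = 1)
    (hP : (P : Set G) = {g : G | ∃ t : R, f g = t • x}) : LocallyCompactSpace P :=
  (isClosed_subgroup_of_coe_eq P f hf hx hP).isClosedEmbedding_subtypeVal.locallyCompactSpace

/-- (m4), the rest of the bundle: `P` is second countable and Hausdorff whenever `G` is (any subgroup). [BorelJacquet1979, §4.1] -/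
theorem secondCountable_t2_subgroup {G : Type*} [Group G] [TopologicalSpace G] [SecondCountableTopology G] [T2Space G] (P : Subgroup G) :
    SecondCountableTopology P ∧ T2Space P :=
  ⟨TopologicalSpace.Subtype.secondCountableTopology _, inferInstance⟩

/-- **A CLOSED SUBGROUP OF A LOCALLY COMPACT GROUP IS LOCALLY COMPACT** (the form V8-inst consumes when `IsClosed P′` comes from elsewhere). [BorelJacquet1979, §4.1] -/
theorem locallyCompactSpace_of_isClosed_subgroup {G : Type*} [Group G] [TopologicalSpace G] [LocallyCompactSpace G] (P : Subgroup G)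
    (hP : IsClosed (P : Set G)) : LocallyCompactSpace P :=
  hP.isClosedEmbedding_subtypeVal.locallyCompactSpace

end Summit.HodgeConjecture.HodgeConjecture.Cruxes.HLiu418.K2LiuIsotropicLineStabiliserClosed
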